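import Mathlib

/-!
# `Balaban1983to89.B8CurlGradHolonomy` — the covariant curl of a covariant gradient is the plaquette holonomy defect (exact lattice identity)

CITATION HEADER (lean-in-tree rule 2026-08-18).  An exact algebraic identity behind one located item of the audit of
T. Bałaban, *Spaces of regular gauge field configurations on a lattice and gauge fixing conditions*, Comm. Math.
Phys. **99**, 75–102 (1985) [Balaban1985GaugeFixing] (cell paper B8; `paper:balaban1985-cmp99-regular-spaces-gauge-fixing`,
journal page = PDF page + 74), Theorem 8 p. 101 and the bound (1.39) p. 83, typed against the definitions of
T. Bałaban, *Propagators for lattice gauge theories in a background field*, Comm. Math. Phys. **99**, 389–434 (1985)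
[Balaban1985BackgroundPropagators] (cell paper B9 = reference [4] of B8; journal page = PDF page + 388), pp. 390–392.
Both papers are UNDER ADJUDICATION by the audit cell `pub-balaban`; nothing of them is asserted here.  Pages re-read as
IMAGES 2026-08-19 by unit b2b-balaban-b08-g14 (renders `…-background-propagators-p002/p003/p004/p006/p008-x2.png` =
B9 pp. 390, 391, 392, 394, 396; `…-regular-spaces-gauge-fixing-p003/p008/p009/p012-x2.png` = B8 pp. 77, 82, 83, 86).
Census rows: GAPS G-B8-13 (gen 1; its aside on (1.39) REINSTATED by the erratum row C-B8-36), GAPS C-B8-37 (this file),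
DIVERGENCE D-b08-g14.3.  Sibling module: `B8HessianSupWitness` (v1.2, §8 `curl_grad_eq_zero` = the flat Abelian
special case of `covCurl_covD_covD_of_trivial` below, on `ℤ × ℤ` with backward/forward differences).

## What is printed

B9 p. 390: "Let us recall that R(U)X = UXU⁻¹." and "Let us introduce covariant derivatives. For a matrix valued
function A defined at points of the lattice we put (D^η_{U₀}A)(b) = η⁻¹(R(U₀(b))A(b₊) − A(b₋)),".
B9 p. 391: "(D^η_{U₀,μ}A)(x) = (D^η_{U₀}A)(x, x + ηe_μ), μ = 1, …, d. (3.3)  For a function A defined at bonds of the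
lattice we put (D^η_{U₀}A)(p) = η⁻¹(A(x, y) + R(U₀(x, y))A(y, z) + R(U₀(x, w))A(z, w) + A(w, x)) (3.4) for a plaquette
p = ⟨x, y, z, w⟩, and if p = p_{μν}(x) = ⟨x, x + ηe_μ, x + ηe_μ + ηe_ν, x + ηe_ν⟩, then we have
(D^η_{U₀}A)(p_{μν}(x)) = (D^η_{U₀}A)_{μν}(x) = (D^η_{U₀,μ}A_ν)(x) − (D^η_{U₀,ν}A_μ)(x).  We have made here the
identification A(x, x + ηe_μ) = A_μ(x)." and "U(x, x′) = U⁻¹(x′, x), A(x, x′) = −A(x′, x) for a bond ⟨x, x′⟩. (3.5)".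
B9 p. 392: "The operator adjoint to derivative D, acting on functions defined at bonds, is the operator acting on
functions F defined at plaquetts by the formula (D*F)(x, x + ηe_μ) = (D*F)_μ(x) = … = Σ_{ν=1}^{d} (D*_ν F_{νμ})(x), (3.9)";
"The quadratic terms in the expansion (3.7) define the basic operator generalizing the operator ∂*∂ in the Abelian
case. We denote it by Δ^η(U), or simply by Δ. … ⟨A, ΔA⟩ = ⟨A, D*DA⟩ + ⟨A, Δ′A⟩, ⟨A, Δ′A⟩ = Σ_{p⊂T_η} η^d tr((D¹_U A)(p))²
η⁻²(Re U(∂p) − 1) + tr Σ_{b₁,b₂⊂∂(p)_z, b₁≺b₂} i[A′(b₁), A′(b₂)]η⁻² Im U(∂p). (3.10)  We have written it this way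
because with our assumptions on the configuration U the operator Δ′ will be a bounded, small operator, which will
be treated as a small perturbation of D*D."; "where J = D*η⁻² Im ∂U, (∂U)(p) = U(∂p)." (after (3.11)).
B8 p. 77 (the class 𝔘_k({Ω_j}, α₀) of (1.33)): "|U(∂p) − 1| < α₀L^{−2j} for p ∈ Ω_j, j = 0, 1, …, k, (1.7)  or
|U(∂p) − 1| < α₀η²(L^jη)⁻² for p ⊂ Ω_j, (1.8)  |(D^{η*}_U ∂U)(b)| < α₀L^{−2j}(L^jη)⁻¹ for b ∈ Ω_j, j = 0, 1, …, k. (1.9)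
We have denoted U(∂p) = (∂U)(p)."
B8 p. 83, (1.39): "Such information is unavailable for the second order derivatives, but we have the following
bounds for the second order operators acting on A: |D^{η*}_{U₀}D^η_{U₀}A|, |Δ^η_{U₀}A| < B₁(α₀ + α₁)(L^jη)⁻³ on Ω_j,
j = 0, 1, …, k. (1.39)".
B8 p. 101, Theorem 8: "… for an arbitrary function f from the space R(U₀) satisfying the bound |f|₍₋₂₎ < γ(α₀ + α₁),
there exists exactly one gauge transformation u satisfying (1.29) and such, that the conditions (1.36), (1.37),
(1.39), and (1.146) hold for the configuration U₁ = U′^{u⁻¹}."; B9 p. 394: "R = R(U) is an orthogonal projection in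
the Hilbert space L²(Ω₀, g) onto the subspace R = Δ^η_U N(Q′), N(Q′) = {λ : Q′λ = 0}. (3.21)".

## What is certified here (kernel; [folklore] lattice gauge calculus, η = 1 — `D^η = η⁻¹D¹`, so the η-scaled
## identity is `η⁻²` times the one below)

* §1 (any monoid `M` acting distributively on an additive group `V`; sites `S` with two shift maps `sμ`, `sν`
  commuting at `x`): with `covD s U f x = U x • f (s x) − f x` ((3.2′)/(3.3): transport from `b₊` to `b₋`) and
  `covCurl` = the second form of (3.4), the EXACT identity
  `covCurl sμ sν Uμ Uν (covD sμ Uμ f) (covD sν Uν f) x = (Uμ x * Uν (sμ x)) • f z − (Uν x * Uμ (sν x)) • f z`,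
  `z = sμ (sν x)` (`covCurl_covD_covD`): the eight first-order terms cancel in pairs and only the two transports of
  `f(z)` along the two lattice paths `x → x+μ → z` and `x → x+ν → z` survive.  For a GROUP `G` this is
  `U(∂p) • v − v` with `v = (Uν x * Uμ (sν x)) • f z` and `U(∂p) = Uμ x * Uν (sμ x) * (Uμ (sν x))⁻¹ * (Uν x)⁻¹`
  (`plaqHol`, the boundary of `p_{μν}(x)` run as `x → x+μ → z → x+ν → x`, backward bonds by (3.5))
  (`covCurl_covD_covD_eq_hol`); flat transporters (`U ≡ 1`) give `0` (`covCurl_covD_covD_of_trivial`).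
* §2 (B9's adjoint action «R(U)X = UXU⁻¹», realised as Mathlib's action of `ConjAct Aˣ` on a ring `A`): the same
  identity in the concrete form `H * v * H⁻¹ − v`, `H = U(∂p)`, `v = W * f z * W⁻¹`, `W = Uν x * Uμ (sν x)`
  (`covCurl_covD_covD_ad`).
* §3 (normed ring `A` — any submultiplicative norm — and transporters with `‖U‖ ≤ 1` and `‖U⁻¹‖ ≤ 1`, e.g.
  unitary matrices in the operator norm): `‖U X U⁻¹ − X‖ ≤ 2‖U − 1‖‖X‖` (`norm_conj_sub_le`) and hence
  `‖(covariant curl ∘ covariant grad f)(p_{μν}(x))‖ ≤ 2 ‖U(∂p) − 1‖ ‖f z‖` (`norm_covCurl_covD_covD_ad_le`).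
  With the η-scaling and B8 (1.8) this reads `|D^η_{U₀}D^η_{U₀}λ|(p) ≤ 2η⁻²‖U₀(∂p) − 1‖ |λ(z)| ≲ 2α₀(L^jη)⁻²|λ(z)|`
  for `p ⊂ Ω_j`, up to the norm-comparison constant recorded in DIVERGENCE D-b08-g14.3 (B9's `|X|` is the
  trace-normalised Hilbert–Schmidt norm, p. 392 «tr 1 = 1», not the operator norm; arithmetic on the printed
  inequality, nothing of B8 asserted).
* §4 sanity instances on `S = ℤ × ℤ` (unit shifts): flat case = forward differences commute; an Abelian charged
  example with one non-trivial transverse link has curl∘grad `= 2 ≠ 0` at the origin (the identity is not vacuous).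

## Why the cell wants it (GAPS C-B8-37; located reasoning, NOT a certification of (1.39))

The erratum C-B8-36 reinstated gen 1's aside in G-B8-13: «(1.39) without the added hypothesis [|D^η_{U₀}f|₍₋₃₎] is
plausible by a reorganised argument … not certified».  This file pins the mechanism such an argument would use and
corrects its description («only mixed second differences diverge»): the operators of (1.39) — `D^{η*}_{U₀}D^η_{U₀}`
and `Δ^η(U₀) = D*D + Δ′` of (3.10) — applied to a pure-gauge increment `D^η_{U₀}λ` never see a second difference
of `λ`: by §1–§3, `D^η_{U₀}D^η_{U₀}λ = η⁻²[R(U₀(∂p)) − 1]·(transported λ)`, so `D^{η*}_{U₀}D^η_{U₀}D^η_{U₀}λ =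
D^{η*}_{U₀}(η⁻²[R(∂U₀) − 1]λ̃)` is, by the lattice Leibniz rule for the (3.9) adjoint, a sum of `2(d − 1)` terms of
the two shapes (derivative of the curvature) × λ and (curvature) × (D^η_{U₀}λ) — the printed class 𝔘_k supplies
exactly these two curvature quantities ((1.8): `η⁻²|U₀(∂p) − 1| < α₀(L^jη)⁻²`; (1.9): `|D^{η*}_{U₀}∂U₀| <
α₀L^{−2j}(L^jη)⁻¹`, cf. B9's current `J = D*η⁻² Im ∂U`), and Theorem 8's printed hypothesis `|f|₍₋₂₎ < γ(α₀ + α₁)`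
supplies `|λ|`, `|D^η_{U₀}λ|₍₋₁₎` through the `G`, `∇G` entries of B9 Theorem 3.3 (the same entries by which the
`|A|`-clause of (1.36) survives in G-B8-13).  The divergent quantity of GAPS C-B8-34 / N-B8-4 (mixed second
differences `∂₁∂₂Δ⁻¹f`, growth `(2/π) ln 2` per doubling; kernel `B8HessianSupWitness`) is therefore INVISIBLE to
(1.39), while it is visible to — and refutes the k-uniformity of — the `∇`- and Hölder clauses of (1.36).
NOT CERTIFIED here (GAPS C-B8-37 says so): the D* Leibniz step with its constants; the decomposition of the
Theorem-8 field into a Theorem-2-type field plus `D^η_{U₀}λ` with `λ ∈ N(Q′)`, `Δ^η_{U₀}λ = f` (possible iff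
`f ∈ R(U₀) = Δ^η_{U₀}N(Q′)`, (3.21) — Theorem 8's «f from the space R(U₀)»), in particular the interaction of
`D^η_{U₀}λ` with the averaging constraints `Q_j(U₀, η·) = B` (B9 p. 394 attributes the linear statement
`Q′_j(U₀)λ` = linear part of the averaged gauge transformation to [5] (78)–(80)); the `Δ′`-part of (3.10) on
`D^η_{U₀}λ` (of sizes `(Re U(∂p) − 1)·(DDλ)²`-form and `η⁻²|Im U(∂p)|·|Dλ|`, both within the same two shapes).
HONEST FRAMING: an exact identity of lattice gauge calculus and a norm inequality, [folklore]; value = located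
mechanism for one aside of the audit (what (1.39) can and cannot see), NOT a proof of (1.39) for Theorem 8, NOT summit
progress.
-/

namespace Literature.MathematicalPhysics.QuantumFieldTheory.Balaban1983to89.B8CurlGradHolonomy

section Action

variable {S M V : Type*} [Monoid M] [AddCommGroup V] [DistribMulAction M V]

/-- [folklore] (B9 p. 390 (3.2′) and p. 391 (3.3) with η = 1.) The covariant derivative of a site function `f` along
the bonds `⟨x, s x⟩`: `(D_U f)(x, s x) = R(U(x, s x)) f(s x) − f(x)`, the transporter `U x` acting on the fibre by `•`
(transport from `b₊ = s x` back to `b₋ = x`). -/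
def covD (s : S → S) (U : S → M) (f : S → V) : S → V := fun x => U x • f (s x) - f x

/-- [folklore] (B9 p. 391 (3.4), second form, η = 1.) The covariant exterior derivative of a bond function with
components `Aμ x = A(x, x+μ)`, `Aν x = A(x, x+ν)` on the plaquette `p_{μν}(x)`:
`(D_U A)_{μν}(x) = (D_{U,μ}A_ν)(x) − (D_{U,ν}A_μ)(x)`. -/
def covCurl (sμ sν : S → S) (Uμ Uν : S → M) (Aμ Aν : S → V) : S → V :=
  fun x => covD sμ Uμ Aν x - covD sν Uν Aμ x

/-- [folklore] unfolding lemma for `covD`. -/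
theorem covD_apply (s : S → S) (U : S → M) (f : S → V) (x : S) :
    covD s U f x = U x • f (s x) - f x := rfl

/-- [folklore] unfolding lemma for `covCurl`. -/
theorem covCurl_apply (sμ sν : S → S) (Uμ Uν : S → M) (Aμ Aν : S → V) (x : S) :
    covCurl sμ sν Uμ Uν Aμ Aν x
      = (Uμ x • Aν (sμ x) - Aν x) - (Uν x • Aμ (sν x) - Aμ x) := rfl

/-- [folklore] **Covariant curl of a covariant gradient = holonomy defect** (exact, any monoid action): if the two
shifts commute at `x` (`z := sμ (sν x) = sν (sμ x)`), then
`(D D f)_{μν}(x) = (Uμ x · Uν (x+μ)) • f z − (Uν x · Uμ (x+ν)) • f z` — the difference of the transports of `f z`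
along the two lattice paths from `z` to `x`; all first-order terms cancel. -/
theorem covCurl_covD_covD (sμ sν : S → S) (Uμ Uν : S → M) (f : S → V) (x : S)
    (h : sν (sμ x) = sμ (sν x)) :
    covCurl sμ sν Uμ Uν (covD sμ Uμ f) (covD sν Uν f) x
      = (Uμ x * Uν (sμ x)) • f (sμ (sν x)) - (Uν x * Uμ (sν x)) • f (sμ (sν x)) := by
  simp only [covCurl, covD, smul_sub, mul_smul, h]
  abel

/-- [folklore] Flat transporters: the curl of a gradient vanishes identically (the abstract form of
`B8HessianSupWitness.curl_grad_eq_zero`). -/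
theorem covCurl_covD_covD_of_trivial (sμ sν : S → S) (f : S → V) (x : S) (h : sν (sμ x) = sμ (sν x)) :
    covCurl sμ sν (fun _ => (1 : M)) (fun _ => (1 : M))
      (covD sμ (fun _ => (1 : M)) f) (covD sν (fun _ => (1 : M)) f) x = 0 := by
  rw [covCurl_covD_covD _ _ _ _ _ _ h]
  simp

end Action

section GroupAction

variable {S G V : Type*} [Group G] [AddCommGroup V] [DistribMulAction G V]

/-- [folklore] (B8 p. 77 «U(∂p) = (∂U)(p)», B9 (3.5).) The holonomy of the plaquette `p_{μν}(x) = ⟨x, x+μ, z, x+ν⟩`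
based at `x`, boundary run as `x → x+μ → z → x+ν → x`, the two backward bonds contributing inverses by (3.5):
`U(∂p) = U(x,x+μ) U(x+μ,z) U(x+ν,z)⁻¹ U(x,x+ν)⁻¹`. -/
def plaqHol (sμ sν : S → S) (Uμ Uν : S → G) (x : S) : G :=
  Uμ x * Uν (sμ x) * (Uμ (sν x))⁻¹ * (Uν x)⁻¹

/-- [folklore] `U(∂p) · U(x→x+ν→z) = U(x→x+μ→z)` (group cancellation). -/
theorem plaqHol_mul_transport (sμ sν : S → S) (Uμ Uν : S → G) (x : S) :
    plaqHol sμ sν Uμ Uν x * (Uν x * Uμ (sν x)) = Uμ x * Uν (sμ x) := by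
  simp [plaqHol, mul_assoc]

/-- [folklore] **Holonomy form**: `(D D f)_{μν}(x) = U(∂p) • v − v` with `v` = `f z` transported to `x` along
`x → x+ν → z`; i.e. the operator `R(U(∂p)) − 1` applied to the transported field — no derivative of `f` survives. -/
theorem covCurl_covD_covD_eq_hol (sμ sν : S → S) (Uμ Uν : S → G) (f : S → V) (x : S)
    (h : sν (sμ x) = sμ (sν x)) :
    covCurl sμ sν Uμ Uν (covD sμ Uμ f) (covD sν Uν f) x
      = plaqHol sμ sν Uμ Uν x • ((Uν x * Uμ (sν x)) • f (sμ (sν x)))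
        - (Uν x * Uμ (sν x)) • f (sμ (sν x)) := by
  rw [covCurl_covD_covD _ _ _ _ _ _ h, smul_smul, plaqHol_mul_transport]

/-- [folklore] Trivial holonomy at `p` ⇒ the curl of the gradient vanishes at `p` (curvature-free plaquette). -/
theorem covCurl_covD_covD_eq_zero_of_hol_eq_one (sμ sν : S → S) (Uμ Uν : S → G) (f : S → V) (x : S)
    (h : sν (sμ x) = sμ (sν x)) (hp : plaqHol sμ sν Uμ Uν x = 1) :
    covCurl sμ sν Uμ Uν (covD sμ Uμ f) (covD sν Uν f) x = 0 := by
  rw [covCurl_covD_covD_eq_hol _ _ _ _ _ _ h, hp, one_smul, sub_self]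

end GroupAction

section Adjoint

variable {S A : Type*} [Ring A]

/-- [folklore] (B9 p. 390 «R(U)X = UXU⁻¹».) The transporters `U : S → Aˣ` acting on `A`-valued (matrix-valued) site functions
by conjugation, realised as Mathlib's action of `ConjAct Aˣ` on `A`. -/
abbrev adT (U : S → Aˣ) : S → ConjAct Aˣ := fun x => ConjAct.toConjAct (U x)

/-- [folklore] the `ConjAct` action is conjugation `X ↦ U X U⁻¹`. -/
theorem adT_smul (U : S → Aˣ) (x : S) (X : A) :
    adT U x • X = (U x : A) * X * ((U x)⁻¹ : Aˣ) := by
  simp [adT, ConjAct.units_smul_def]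

/-- [folklore] `covD` in the adjoint action: `U(x) f(s x) U(x)⁻¹ − f(x)`. -/
theorem covD_adT_apply (s : S → S) (U : S → Aˣ) (f : S → A) (x : S) :
    covD s (adT U) f x = (U x : A) * f (s x) * ((U x)⁻¹ : Aˣ) - f x := by
  rw [covD_apply, adT_smul]

/-- [folklore] the holonomy of the conjugation-valued transporters is the conjugation by the holonomy. -/
theorem plaqHol_adT (sμ sν : S → S) (Uμ Uν : S → Aˣ) (x : S) :
    plaqHol sμ sν (adT Uμ) (adT Uν) x = ConjAct.toConjAct (plaqHol sμ sν Uμ Uν x) := by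
  simp [plaqHol, adT, map_mul, map_inv]

/-- [folklore] The identity in B9's concrete adjoint form: `(D D f)_{μν}(x) = H v H⁻¹ − v`, `H = U(∂p)`,
`v = W f(z) W⁻¹`, `W = U(x,x+ν)U(x+ν,z)`. -/
theorem covCurl_covD_covD_ad (sμ sν : S → S) (Uμ Uν : S → Aˣ) (f : S → A) (x : S)
    (h : sν (sμ x) = sμ (sν x)) :
    covCurl sμ sν (adT Uμ) (adT Uν) (covD sμ (adT Uμ) f) (covD sν (adT Uν) f) x
      = ((plaqHol sμ sν Uμ Uν x : Aˣ) : A)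
          * ((Uν x * Uμ (sν x) : Aˣ) * f (sμ (sν x)) * ((Uν x * Uμ (sν x))⁻¹ : Aˣ))
          * ((plaqHol sμ sν Uμ Uν x)⁻¹ : Aˣ)
        - (Uν x * Uμ (sν x) : Aˣ) * f (sμ (sν x)) * ((Uν x * Uμ (sν x))⁻¹ : Aˣ) := by
  have hW : (adT Uν x * adT Uμ (sν x) : ConjAct Aˣ) = ConjAct.toConjAct (Uν x * Uμ (sν x)) := by
    simp [adT, map_mul]
  rw [covCurl_covD_covD_eq_hol _ _ _ _ _ _ h, plaqHol_adT, hW]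
  simp only [ConjAct.units_smul_def, ConjAct.ofConjAct_toConjAct]

end Adjoint

section Norms

variable {S A : Type*} [NormedRing A]

/-- [folklore] `‖U X U⁻¹ − X‖ ≤ 2‖U − 1‖‖X‖` for a unit `U` with `‖U⁻¹‖ ≤ 1` (e.g. unitary matrices in the
operator norm): `UXU⁻¹ − X = (U − 1)XU⁻¹ + X(U⁻¹ − 1)` and `U⁻¹ − 1 = U⁻¹(1 − U)`. -/
theorem norm_conj_sub_le (u : Aˣ) (X : A) (hu' : ‖((u⁻¹ : Aˣ) : A)‖ ≤ 1) :
    ‖(u : A) * X * ((u⁻¹ : Aˣ) : A) - X‖ ≤ 2 * ‖(u : A) - 1‖ * ‖X‖ := by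
  have hba : ((u⁻¹ : Aˣ) : A) * (u : A) = 1 := Units.inv_mul u
  have e : (u : A) * X * ((u⁻¹ : Aˣ) : A) - X
      = ((u : A) - 1) * X * ((u⁻¹ : Aˣ) : A) + X * (((u⁻¹ : Aˣ) : A) - 1) := by
    noncomm_ring
  have hb : ((u⁻¹ : Aˣ) : A) - 1 = ((u⁻¹ : Aˣ) : A) * (1 - (u : A)) := by
    rw [mul_sub, mul_one, hba]
  have h1 : ‖((u : A) - 1) * X * ((u⁻¹ : Aˣ) : A)‖ ≤ ‖(u : A) - 1‖ * ‖X‖ := by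
    calc ‖((u : A) - 1) * X * ((u⁻¹ : Aˣ) : A)‖
        ≤ ‖((u : A) - 1) * X‖ * ‖((u⁻¹ : Aˣ) : A)‖ := norm_mul_le _ _
      _ ≤ ‖((u : A) - 1) * X‖ * 1 := by gcongr
      _ ≤ ‖(u : A) - 1‖ * ‖X‖ := by rw [mul_one]; exact norm_mul_le _ _
  have h2 : ‖X * (((u⁻¹ : Aˣ) : A) - 1)‖ ≤ ‖X‖ * ‖(u : A) - 1‖ := by
    have h3 : ‖((u⁻¹ : Aˣ) : A) - 1‖ ≤ ‖(u : A) - 1‖ := by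
      rw [hb]
      calc ‖((u⁻¹ : Aˣ) : A) * (1 - (u : A))‖
          ≤ ‖((u⁻¹ : Aˣ) : A)‖ * ‖1 - (u : A)‖ := norm_mul_le _ _
        _ ≤ 1 * ‖1 - (u : A)‖ := by gcongr
        _ = ‖(u : A) - 1‖ := by rw [one_mul, norm_sub_rev]
    calc ‖X * (((u⁻¹ : Aˣ) : A) - 1)‖ ≤ ‖X‖ * ‖((u⁻¹ : Aˣ) : A) - 1‖ := norm_mul_le _ _
      _ ≤ ‖X‖ * ‖(u : A) - 1‖ := by gcongr
  rw [e]
  calc ‖((u : A) - 1) * X * ((u⁻¹ : Aˣ) : A) + X * (((u⁻¹ : Aˣ) : A) - 1)‖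
      ≤ ‖((u : A) - 1) * X * ((u⁻¹ : Aˣ) : A)‖ + ‖X * (((u⁻¹ : Aˣ) : A) - 1)‖ := norm_add_le _ _
    _ ≤ ‖(u : A) - 1‖ * ‖X‖ + ‖X‖ * ‖(u : A) - 1‖ := add_le_add h1 h2
    _ = 2 * ‖(u : A) - 1‖ * ‖X‖ := by ring

/-- [folklore] `‖W X W⁻¹‖ ≤ ‖X‖` when `‖W‖ ≤ 1` and `‖W⁻¹‖ ≤ 1`. -/
theorem norm_conj_le (w : Aˣ) (X : A) (hw : ‖(w : A)‖ ≤ 1) (hw' : ‖((w⁻¹ : Aˣ) : A)‖ ≤ 1) :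
    ‖(w : A) * X * ((w⁻¹ : Aˣ) : A)‖ ≤ ‖X‖ := by
  calc ‖(w : A) * X * ((w⁻¹ : Aˣ) : A)‖ ≤ ‖(w : A) * X‖ * ‖((w⁻¹ : Aˣ) : A)‖ := norm_mul_le _ _
    _ ≤ (‖(w : A)‖ * ‖X‖) * 1 := by gcongr; exact norm_mul_le _ _
    _ ≤ (1 * ‖X‖) * 1 := by gcongr
    _ = ‖X‖ := by ring

/-- [folklore] products of two norm-`≤ 1` units have norm `≤ 1`. -/
theorem norm_units_mul_le_one (a b : Aˣ) (ha : ‖(a : A)‖ ≤ 1) (hb : ‖(b : A)‖ ≤ 1) :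
    ‖((a * b : Aˣ) : A)‖ ≤ 1 := by
  rw [Units.val_mul]
  exact (norm_mul_le _ _).trans (mul_le_one₀ ha (norm_nonneg _) hb)

/-- [folklore] the inverse of a product of two units with norm-`≤ 1` inverses has norm `≤ 1`. -/
theorem norm_units_inv_mul_le_one (a b : Aˣ) (ha : ‖((a⁻¹ : Aˣ) : A)‖ ≤ 1) (hb : ‖((b⁻¹ : Aˣ) : A)‖ ≤ 1) :
    ‖(((a * b)⁻¹ : Aˣ) : A)‖ ≤ 1 := by
  rw [mul_inv_rev, Units.val_mul]
  exact (norm_mul_le _ _).trans (mul_le_one₀ hb (norm_nonneg _) ha)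

/-- [folklore] **Norm form** (η = 1): for transporters of norm `≤ 1` with inverses of norm `≤ 1`,
`‖(D D f)_{μν}(x)‖ ≤ 2 ‖U(∂p) − 1‖ ‖f z‖`.  With `D^η = η⁻¹D¹` and B8 (1.8) (`|U₀(∂p) − 1| < α₀η²(L^jη)⁻²` on `Ω_j`)
this is `|D^η_{U₀}D^η_{U₀}λ|(p) ≲ 2α₀(L^jη)⁻²|λ(z)|` (up to the norm comparison of DIVERGENCE D-b08-g14.3) —
curvature × field, no second difference of `λ`. -/
theorem norm_covCurl_covD_covD_ad_le (sμ sν : S → S) (Uμ Uν : S → Aˣ) (f : S → A) (x : S)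
    (h : sν (sμ x) = sμ (sν x))
    (hμ : ∀ y, ‖(Uμ y : A)‖ ≤ 1) (hμ' : ∀ y, ‖(((Uμ y)⁻¹ : Aˣ) : A)‖ ≤ 1)
    (hν : ∀ y, ‖(Uν y : A)‖ ≤ 1) (hν' : ∀ y, ‖(((Uν y)⁻¹ : Aˣ) : A)‖ ≤ 1) :
    ‖covCurl sμ sν (adT Uμ) (adT Uν) (covD sμ (adT Uμ) f) (covD sν (adT Uν) f) x‖
      ≤ 2 * ‖((plaqHol sμ sν Uμ Uν x : Aˣ) : A) - 1‖ * ‖f (sμ (sν x))‖ := by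
  rw [covCurl_covD_covD_ad _ _ _ _ _ _ h]
  have hH' : ‖(((plaqHol sμ sν Uμ Uν x)⁻¹ : Aˣ) : A)‖ ≤ 1 := by
    have e : (plaqHol sμ sν Uμ Uν x)⁻¹ = (Uν x * Uμ (sν x)) * (Uμ x * Uν (sμ x))⁻¹ := by
      simp [plaqHol, mul_inv_rev, mul_assoc]
    rw [e, Units.val_mul]
    refine (norm_mul_le _ _).trans (mul_le_one₀ ?_ (norm_nonneg _) ?_)
    · exact norm_units_mul_le_one _ _ (hν x) (hμ (sν x))
    · exact norm_units_inv_mul_le_one _ _ (hμ' x) (hν' (sμ x))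
  have hv : ‖((Uν x * Uμ (sν x) : Aˣ) : A) * f (sμ (sν x)) * (((Uν x * Uμ (sν x))⁻¹ : Aˣ) : A)‖
      ≤ ‖f (sμ (sν x))‖ :=
    norm_conj_le _ _ (norm_units_mul_le_one _ _ (hν x) (hμ (sν x)))
      (norm_units_inv_mul_le_one _ _ (hν' x) (hμ' (sν x)))
  calc _ ≤ 2 * ‖((plaqHol sμ sν Uμ Uν x : Aˣ) : A) - 1‖
            * ‖((Uν x * Uμ (sν x) : Aˣ) : A) * f (sμ (sν x)) * (((Uν x * Uμ (sν x))⁻¹ : Aˣ) : A)‖ :=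
        norm_conj_sub_le _ _ hH'
    _ ≤ 2 * ‖((plaqHol sμ sν Uμ Uν x : Aˣ) : A) - 1‖ * ‖f (sμ (sν x))‖ := by gcongr

end Norms

section Instances

/-- [folklore] unit shift in the first lattice direction of `ℤ × ℤ` -/
def sh1 : ℤ × ℤ → ℤ × ℤ := fun x => (x.1 + 1, x.2)
/-- [folklore] unit shift in the second lattice direction of `ℤ × ℤ` -/
def sh2 : ℤ × ℤ → ℤ × ℤ := fun x => (x.1, x.2 + 1)

/-- [folklore] the two unit shifts of `ℤ × ℤ` commute. -/
theorem sh_comm (x : ℤ × ℤ) : sh2 (sh1 x) = sh1 (sh2 x) := by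
  simp [sh1, sh2]

/-- [folklore] Flat case on `ℤ × ℤ` (trivial transporters in the multiplicative monoid of `ℚ` acting on `ℚ`): `covD` is the
forward difference and the two forward differences commute — the lattice `curl ∘ grad = 0`. -/
theorem flat_covD_eq_forwardDiff (f : ℤ × ℤ → ℚ) (x : ℤ × ℤ) :
    covD sh1 (fun _ => (1 : ℚ)) f x = f (x.1 + 1, x.2) - f x := by
  simp [covD, sh1]

/-- [folklore] flat `ℤ × ℤ`: the lattice curl of the lattice gradient vanishes (cf. `B8HessianSupWitness.curl_grad_eq_zero`). -/
theorem flat_curl_grad_eq_zero (f : ℤ × ℤ → ℚ) (x : ℤ × ℤ) :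
    covCurl sh1 sh2 (fun _ => (1 : ℚ)) (fun _ => (1 : ℚ))
      (covD sh1 (fun _ => (1 : ℚ)) f) (covD sh2 (fun _ => (1 : ℚ)) f) x = 0 :=
  covCurl_covD_covD_of_trivial _ _ _ _ (sh_comm x)

/-- [folklore] Non-vacuity: an Abelian charged field (`ℚ` acting on `ℚ` by multiplication) with a single non-trivial
transverse link `U₂(1, n) = 3` has `curl ∘ grad f = (1·3 − 1·1)·f(1,1) = 2` at the origin for `f ≡ 1`. -/
example :
    covCurl sh1 sh2 (fun _ => (1 : ℚ)) (fun y : ℤ × ℤ => if y.1 = 1 then (3 : ℚ) else 1)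
      (covD sh1 (fun _ => (1 : ℚ)) (fun _ => (1 : ℚ)))
      (covD sh2 (fun y : ℤ × ℤ => if y.1 = 1 then (3 : ℚ) else 1) (fun _ => (1 : ℚ))) (0, 0) = 2 := by
  rw [covCurl_covD_covD _ _ _ _ _ _ (sh_comm _)]
  norm_num [sh1, sh2]

end Instances

end Literature.MathematicalPhysics.QuantumFieldTheory.Balaban1983to89.B8CurlGradHolonomy
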